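import Literature.MathematicalPhysics.QuantumFieldTheory.QCDTimeReflection
import Literature.MathematicalPhysics.QuantumFieldTheory.FermionFlow
import HarnessLib

/-!
# The current sector of Wilson lattice QCD: quark bilinears, the conserved vector current, the
# local axial current and pseudoscalar density, three-point torus transforms, reflected pairings

Definition request `QCDCurrentSector` (route AnomalyRigidity of `QuantumFields/QCD`, crux
`AnomalousWardTriple`, Two-layer plan `LightChiralFamily → AnomalyNonRenormalisation`): the
vocabulary of gauge-invariant QUARK BILINEARS as `QCDLatticeObservable`s of `QCDOS` — none existed in
the tree — and the two functionals the crux spells out inline (the physical-momentum torus transform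
of a three-point function and the truncated reflected pairing).

## Content

* `fermiGaugeLin_single_inr/inl`, `fermiGaugeAct_boxQ`, `fermiGaugeAct_boxQbar` — the gauge action
  `QCDOS.fermiGaugeAct` on the quark generators: `ψ_{x,a} ↦ ∑_b g(x)_{ab} ψ_{x,b}`,
  `ψ̄_{x,a} ↦ ∑_b (g(x)⁻¹)_{ba} ψ̄_{x,b}` (Montvay–Münster (5.3)).
* `boxBilinear f g x y Γ M = ∑ Γ_{αβ} M_{ab} ψ̄_{f,x,a,α} ψ_{g,y,b,β}` and its transformation law
  `g · (ψ̄_x Γ M ψ_y) = ψ̄_x Γ (g(x)⁻¹ M g(y)) ψ_y` (`fermiGaugeAct_boxBilinear`).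
* `QuarkTransporter R` — a gauge-COVARIANT colour matrix `W(U)` between two sites of the quark box
  (`W(U^g) = g(src) W(U) g(tgt)⁻¹`; bounded measurable cylinder): the unit transporter `refl x`, the
  link `link x μ` (`W = U(x,μ)`, from `x + μ̂` to `x` in the tree's orientation
  `U(x,μ) ↦ g(x)U(x,μ)g(x+μ̂)⁻¹`) and its inverse `linkInv x μ`; `bilinearObs τ T Γ :
  QCDLatticeObservable Nf R`, the gauge-invariant bilinear `∑_{fg} T_{fg} ψ̄_f(src) Γ W(U) ψ_g(tgt)`
  with flavour matrix `T`, all four obligations (cylinder, joint gauge invariance, bounded and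
  measurable Berezin coefficients) PROVED; `Add`/`SMul ℂ`/`Neg`/`Sub` on `QCDLatticeObservable`.
* The named currents at the origin (quark box `R = 1`): `localBilinearObs x T Γ` (`ψ̄(x) Γ T ψ(x)`),
  `conservedVectorCurrent T μ` — the CONSERVED point-split Wilson vector current (Karsten–Smit;
  Montvay–Münster (4.255)/(5.149), `r = 1`, written in the tree's link orientation
  `U_tree(x,μ) = U_MM(x,μ)⁺`):
  `V_μ(0) = ½[ψ̄(μ̂)(1+γ_μ)U(0,μ)⁻¹ T ψ(0) − ψ̄(0)(1−γ_μ)U(0,μ) T ψ(μ̂)]` (single flavour `f`: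
  `T = Matrix.single f f 1`, `conservedVectorCurrentOfFlavour`), `axialCurrentObs T μ = ψ̄(0) γ_μγ₅ T ψ(0)`
  ((5.151)), `pseudoscalarDensityObs T = ψ̄(0) γ₅ T ψ(0)` (the density of the axial Ward identities
  (4.260)/(5.155)).
* `torusBilinear` (the same bilinear in the torus variables `qbar`/`q`; `torusBilinear_one`:
  consistency with `FermionFlow.quarkBilinear`), `map_place_boxQbar/boxQ`, `bilinearObs_onTorus`,
  `conservedVectorCurrent_onTorus`, `localBilinearObs_onTorus` — what `onTorus` makes of them.
* `qcdThreePoint`, `qcdThreePointTransform` — `⟨X(x) Y(y) Z(0)⟩_{β,2S+1,m}` over `qcdTorusExpect` and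
  its physical-momentum torus transform `a⁸ ∑_{x,y ∈ box S} e^{i a (p·x + q·y)} ⟨X(x)Y(y)Z(0)⟩`.
* `reflectedPair`, `pairProduct`, `qcdTruncatedReflectedPairing` —
  `⟨ΘY(θy) ΘX(θx) · X(x) Y(y)⟩ − ⟨ΘY(θy) ΘX(θx)⟩⟨X(x) Y(y)⟩` (`osAdjoint`, `siteReflect`).

## Sources

I. Montvay, G. Münster, *Quantum Fields on a Lattice* (CUP 1994): §4.4.2 (4.245)–(4.255) (Wilson
action in an external field, gauge transformation (4.247), the vector Ward–Takahashi identity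
(4.254) and the conserved current (4.255)), (4.259)–(4.262) (axial current, anomalous W–T identity);
§5.1.1 (5.3)–(5.5) (gauge transformation of quark fields, lattice QCD action); §5.3.1
(5.146)–(5.155) (flavour currents: conserved vector current (5.149), local axial current (5.151),
W–T identities (5.150), (5.155)). L. H. Karsten, J. Smit, Nucl. Phys. B183 (1981) 103 (conserved
current and the triangle anomaly with Wilson fermions); M. Bochicchio, L. Maiani, G. Martinelli,
G. Rossi, M. Testa, Nucl. Phys. B262 (1985) 331 (chiral Ward identities with Wilson fermions).

## Conventions (checked against the tree)

`gaugeTransformZd g U (x,μ) = g(x) U(x,μ) g(x+μ̂)⁻¹` and the hopping term of `wilsonDirac` is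
`−½ ∑_μ [ψ̄_x (r−γ_μ) U(x,μ) ψ_{x+μ̂} + ψ̄_{x+μ̂} (r+γ_μ) U(x,μ)⁻¹ ψ_x]`, i.e. Montvay–Münster (4.249)/(5.5)
with `U_tree(x,μ) = U_MM(x,μ)⁺`; every formula below is (4.255)/(5.149)/(5.151) under this
dictionary at `a = 1`, `r = 1`.

## Not here

The exact lattice vector Ward identity with insertions, (5.150)
`⟨𝒪 Δ^b_μ V_{xμ}⟩ + ⟨contact terms⟩ = 0`: its contact terms are Grassmann left/right derivatives of
the insertion `𝒪`, which the tree's Grassmann calculus (`GrassmannIntegral`) does not yet carry; no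
named fact is introduced for it (to be vendored with that calculus, or proved from a Berezin
change of variables).
-/

open MeasureTheory
open Literature.Probability Literature.Probability.LatticeModels Literature.MathematicalPhysics.QuantumLattice

noncomputable section

namespace Literature.MathematicalPhysics.QuantumFieldTheory

local notation "𝔾" => Matrix.specialUnitaryGroup (Fin 3) ℂ

variable {Nf R : ℕ}

/-! ### The gauge action on the quark generators -/

section GaugeAction

/-- The gauge substitution on the coefficient vector of `ψ_{f,x,a,α}`:
`e_{ψ,(f,x,a,α)} ↦ ∑_b g(x)_{ab} e_{ψ,(f,x,b,α)}`. [cite: MontvayMunster1994, §5.1.1 (5.3)] -/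
theorem fermiGaugeLin_single_inr (g : LatticeModels.Site 4 → 𝔾) (f : Fin Nf) (x : ↥(box 4 R))
    (a : Fin 3) (α : Fin 4) :
    fermiGaugeLin (Nf := Nf) (R := R) g
        (Pi.single (toLex (Sum.inr (boxQuarkEquiv (f, (x, a, α))))) (1 : ℂ)) =
      ∑ b : Fin 3, ((g x : 𝔾) : Matrix (Fin 3) (Fin 3) ℂ) a b •
        Pi.single (toLex (Sum.inr (boxQuarkEquiv (Nf := Nf) (R := R) (f, (x, b, α))))) (1 : ℂ) := by
  funext w
  obtain ⟨y, rfl⟩ : ∃ y, toLex y = w := ⟨ofLex w, rfl⟩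
  rcases y with i | i
  · simp only [fermiGaugeLin, LinearMap.pi_apply, ofLex_toLex, LinearMap.coe_sum, Finset.sum_apply,
      LinearMap.smul_apply, LinearMap.proj_apply, Pi.single_apply, Pi.smul_apply, smul_eq_mul,
      toLex_inj, reduceCtorEq, if_false, mul_zero, Finset.sum_const_zero]
  · obtain ⟨⟨f', x', b', α'⟩, rfl⟩ := boxQuarkEquiv.surjective i
    simp only [fermiGaugeLin, LinearMap.pi_apply, ofLex_toLex, LinearMap.coe_sum, Finset.sum_apply,
      LinearMap.smul_apply, LinearMap.proj_apply, Equiv.symm_apply_apply, Pi.single_apply,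
      Pi.smul_apply, smul_eq_mul, Sum.inr.injEq, EmbeddingLike.apply_eq_iff_eq, Prod.mk.injEq,
      mul_ite, mul_one, mul_zero]
    by_cases hf : f' = f
    · by_cases hx : x' = x
      · by_cases hα : α' = α
        · subst hf hx hα
          simp [Finset.sum_ite_eq', Finset.sum_ite_eq]
        · simp [hα]
      · simp [hx]
    · simp [hf]

/-- The gauge substitution on the coefficient vector of `ψ̄_{f,x,a,α}`:
`e_{ψ̄,(f,x,a,α)} ↦ ∑_b (g(x)⁻¹)_{ba} e_{ψ̄,(f,x,b,α)}`. [cite: MontvayMunster1994, §5.1.1 (5.3)] -/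
theorem fermiGaugeLin_single_inl (g : LatticeModels.Site 4 → 𝔾) (f : Fin Nf) (x : ↥(box 4 R))
    (a : Fin 3) (α : Fin 4) :
    fermiGaugeLin (Nf := Nf) (R := R) g
        (Pi.single (toLex (Sum.inl (boxQuarkEquiv (f, (x, a, α))))) (1 : ℂ)) =
      ∑ b : Fin 3, (((g x)⁻¹ : 𝔾) : Matrix (Fin 3) (Fin 3) ℂ) b a •
        Pi.single (toLex (Sum.inl (boxQuarkEquiv (Nf := Nf) (R := R) (f, (x, b, α))))) (1 : ℂ) := by
  funext w
  obtain ⟨y, rfl⟩ : ∃ y, toLex y = w := ⟨ofLex w, rfl⟩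
  rcases y with i | i
  · obtain ⟨⟨f', x', b', α'⟩, rfl⟩ := boxQuarkEquiv.surjective i
    simp only [fermiGaugeLin, LinearMap.pi_apply, ofLex_toLex, LinearMap.coe_sum, Finset.sum_apply,
      LinearMap.smul_apply, LinearMap.proj_apply, Equiv.symm_apply_apply, Pi.single_apply,
      Pi.smul_apply, smul_eq_mul, Sum.inl.injEq, EmbeddingLike.apply_eq_iff_eq, Prod.mk.injEq,
      mul_ite, mul_one, mul_zero]
    by_cases hf : f' = f
    · by_cases hx : x' = x
      · by_cases hα : α' = α
        · subst hf hx hα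
          simp [Finset.sum_ite_eq', Finset.sum_ite_eq]
        · simp [hα]
      · simp [hx]
    · simp [hf]
  · simp only [fermiGaugeLin, LinearMap.pi_apply, ofLex_toLex, LinearMap.coe_sum, Finset.sum_apply,
      LinearMap.smul_apply, LinearMap.proj_apply, Pi.single_apply, Pi.smul_apply, smul_eq_mul,
      toLex_inj, reduceCtorEq, if_false, mul_zero, Finset.sum_const_zero]

/-- **`ψ ↦ g ψ`**: `g · ψ_{f,x,a,α} = ∑_b g(x)_{ab} ψ_{f,x,b,α}` (Montvay–Münster (5.3),
`ψ'_x = Λ_x⁻¹ ψ_x` with `g = Λ⁻¹`). [cite: MontvayMunster1994, §5.1.1 (5.3)] -/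
theorem fermiGaugeAct_boxQ (g : LatticeModels.Site 4 → 𝔾) (f : Fin Nf) (x : ↥(box 4 R))
    (a : Fin 3) (α : Fin 4) :
    fermiGaugeAct g (boxQ (f, (x, a, α))) =
      ∑ b : Fin 3, ((g x : 𝔾) : Matrix (Fin 3) (Fin 3) ℂ) a b • boxQ (Nf := Nf) (f, (x, b, α)) := by
  simp only [boxQ, psi, GrassmannAlgebra.gen, fermiGaugeAct, ExteriorAlgebra.map_apply_ι,
    fermiGaugeLin_single_inr, map_sum, map_smul]

/-- **`ψ̄ ↦ ψ̄ g⁻¹`**: `g · ψ̄_{f,x,a,α} = ∑_b (g(x)⁻¹)_{ba} ψ̄_{f,x,b,α}`. [cite: MontvayMunster1994, §5.1.1 (5.3)] -/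
theorem fermiGaugeAct_boxQbar (g : LatticeModels.Site 4 → 𝔾) (f : Fin Nf) (x : ↥(box 4 R))
    (a : Fin 3) (α : Fin 4) :
    fermiGaugeAct g (boxQbar (f, (x, a, α))) =
      ∑ b : Fin 3, (((g x)⁻¹ : 𝔾) : Matrix (Fin 3) (Fin 3) ℂ) b a • boxQbar (Nf := Nf) (f, (x, b, α)) := by
  simp only [boxQbar, psiBar, GrassmannAlgebra.gen, fermiGaugeAct, ExteriorAlgebra.map_apply_ι,
    fermiGaugeLin_single_inl, map_sum, map_smul]

/-- `SU(3)` bookkeeping: the matrix of `A⁻¹` is `A†`. [folklore] -/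
theorem specialUnitary_coe_inv (A : 𝔾) :
    (((A⁻¹ : 𝔾)) : Matrix (Fin 3) (Fin 3) ℂ) = star (A : Matrix (Fin 3) (Fin 3) ℂ) := by
  rw [← Matrix.star_eq_inv]; rfl

/-- `SU(3)` bookkeeping: `A A⁻¹ = 1` as matrices. [folklore] -/
theorem specialUnitary_coe_mul_coe_inv (A : 𝔾) :
    (A : Matrix (Fin 3) (Fin 3) ℂ) * (((A⁻¹ : 𝔾)) : Matrix (Fin 3) (Fin 3) ℂ) = 1 := by
  rw [specialUnitary_coe_inv]
  exact Unitary.mul_star_self_of_mem (Matrix.specialUnitaryGroup_le_unitaryGroup A.2)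

/-- `SU(3)` bookkeeping: `A⁻¹ A = 1` as matrices. [folklore] -/
theorem specialUnitary_coe_inv_mul_coe (A : 𝔾) :
    (((A⁻¹ : 𝔾)) : Matrix (Fin 3) (Fin 3) ℂ) * (A : Matrix (Fin 3) (Fin 3) ℂ) = 1 := by
  rw [specialUnitary_coe_inv]
  exact Unitary.star_mul_self_of_mem (Matrix.specialUnitaryGroup_le_unitaryGroup A.2)

end GaugeAction

/-! ### Quark bilinears -/

section Bilinear

/-- **The quark bilinear** `ψ̄_f(x) Γ M ψ_g(y) = ∑_{α,β,a,b} Γ_{αβ} M_{ab} ψ̄_{f,x,a,α} ψ_{g,y,b,β}`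
with spin matrix `Γ` and colour matrix `M` (for `M` a parallel transporter from `y` to `x` this is a
gauge-invariant meson field / current density). [cite: MontvayMunster1994, §5.3.1 (5.149)–(5.153)] -/
def boxBilinear (f g : Fin Nf) (x y : ↥(box 4 R)) (Γ : Matrix (Fin 4) (Fin 4) ℂ)
    (M : Matrix (Fin 3) (Fin 3) ℂ) : BoxFermiAlg Nf R :=
  ∑ α : Fin 4, ∑ β : Fin 4, ∑ a : Fin 3, ∑ b : Fin 3,
    (Γ α β * M a b) • (boxQbar (f, (x, a, α)) * boxQ (g, (y, b, β)))

/-- The bilinear is additive in the colour matrix. [folklore] -/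
theorem boxBilinear_add (f g : Fin Nf) (x y : ↥(box 4 R)) (Γ : Matrix (Fin 4) (Fin 4) ℂ)
    (M N : Matrix (Fin 3) (Fin 3) ℂ) :
    boxBilinear f g x y Γ (M + N) = boxBilinear f g x y Γ M + boxBilinear f g x y Γ N := by
  simp only [boxBilinear, Matrix.add_apply, mul_add, add_smul, Finset.sum_add_distrib]

/-- The bilinear is additive in the spin matrix. [folklore] -/
theorem boxBilinear_add_left (f g : Fin Nf) (x y : ↥(box 4 R)) (Γ Γ' : Matrix (Fin 4) (Fin 4) ℂ)
    (M : Matrix (Fin 3) (Fin 3) ℂ) :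
    boxBilinear f g x y (Γ + Γ') M = boxBilinear f g x y Γ M + boxBilinear f g x y Γ' M := by
  simp only [boxBilinear, Matrix.add_apply, add_mul, add_smul, Finset.sum_add_distrib]

/-- The bilinear is homogeneous in the colour matrix. [folklore] -/
theorem boxBilinear_smul (f g : Fin Nf) (x y : ↥(box 4 R)) (Γ : Matrix (Fin 4) (Fin 4) ℂ)
    (c : ℂ) (M : Matrix (Fin 3) (Fin 3) ℂ) :
    boxBilinear f g x y Γ (c • M) = c • boxBilinear f g x y Γ M := by
  simp only [boxBilinear, Matrix.smul_apply, smul_eq_mul, Finset.smul_sum, smul_smul]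
  refine Finset.sum_congr rfl fun α _ => Finset.sum_congr rfl fun β _ =>
    Finset.sum_congr rfl fun a _ => Finset.sum_congr rfl fun b _ => ?_
  ring_nf

/-- Reordering (reversal) of a fourfold finite sum (colour bookkeeping). [folklore] -/
private theorem sum_comm₄ {M : Type*} [AddCommMonoid M] (F : Fin 3 → Fin 3 → Fin 3 → Fin 3 → M) :
    ∑ a, ∑ b, ∑ c, ∑ d, F a b c d = ∑ d, ∑ c, ∑ b, ∑ a, F a b c d :=
  calc ∑ a, ∑ b, ∑ c, ∑ d, F a b c d
      = ∑ a, ∑ b, ∑ d, ∑ c, F a b c d :=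
        Finset.sum_congr rfl fun _ _ => Finset.sum_congr rfl fun _ _ => Finset.sum_comm
    _ = ∑ a, ∑ d, ∑ b, ∑ c, F a b c d := Finset.sum_congr rfl fun _ _ => Finset.sum_comm
    _ = ∑ d, ∑ a, ∑ b, ∑ c, F a b c d := Finset.sum_comm
    _ = ∑ d, ∑ a, ∑ c, ∑ b, F a b c d :=
        Finset.sum_congr rfl fun _ _ => Finset.sum_congr rfl fun _ _ => Finset.sum_comm
    _ = ∑ d, ∑ c, ∑ a, ∑ b, F a b c d := Finset.sum_congr rfl fun _ _ => Finset.sum_comm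
    _ = ∑ d, ∑ c, ∑ b, ∑ a, F a b c d :=
        Finset.sum_congr rfl fun _ _ => Finset.sum_congr rfl fun _ _ => Finset.sum_comm

/-- **Gauge transformation of a bilinear**: `g · (ψ̄_f(x) Γ M ψ_g(y)) = ψ̄_f(x) Γ (g(x)⁻¹ M g(y)) ψ_g(y)`
— so the bilinear is invariant exactly when `M` is read from a parallel transporter
`M(U^g) = g(x) M(U) g(y)⁻¹`. [cite: MontvayMunster1994, §5.1.1 (5.3)–(5.5)] -/
theorem fermiGaugeAct_boxBilinear (u : LatticeModels.Site 4 → 𝔾) (f g : Fin Nf) (x y : ↥(box 4 R))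
    (Γ : Matrix (Fin 4) (Fin 4) ℂ) (M : Matrix (Fin 3) (Fin 3) ℂ) :
    fermiGaugeAct u (boxBilinear f g x y Γ M) =
      boxBilinear f g x y Γ
        ((((u x)⁻¹ : 𝔾) : Matrix (Fin 3) (Fin 3) ℂ) * M * ((u y : 𝔾) : Matrix (Fin 3) (Fin 3) ℂ)) := by
  simp only [boxBilinear, map_sum, map_smul, map_mul, fermiGaugeAct_boxQbar, fermiGaugeAct_boxQ,
    Finset.sum_mul, Finset.mul_sum, smul_mul_assoc, mul_smul_comm, smul_smul, Finset.smul_sum,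
    Matrix.mul_apply, Finset.sum_smul]
  refine Finset.sum_congr rfl fun α _ => Finset.sum_congr rfl fun β _ => ?_
  rw [sum_comm₄]
  refine Finset.sum_congr rfl fun a' _ => Finset.sum_congr rfl fun b' _ =>
    Finset.sum_congr rfl fun b _ => Finset.sum_congr rfl fun a _ => ?_
  congr 1
  ring

end Bilinear

/-! ### Parallel transporters and the gauge-invariant bilinear observables -/

section Transporter

variable (R) in
/-- **A parallel transporter between two sites of the quark box**: a colour matrix `W(U)` read from
finitely many links (`IsCylinder`), gauge COVARIANT — `W(U^g) = g(src) W(U) g(tgt)⁻¹` — with bounded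
measurable entries; e.g. `1` (`src = tgt`), a link, a product of links along a path from `tgt` to
`src`. It is exactly the datum making `ψ̄(src) Γ W(U) ψ(tgt)` gauge invariant. [cite: MontvayMunster1994, §5.1.1 (5.3)–(5.5)] -/
structure QuarkTransporter where
  /-- the site of `ψ̄` -/
  src : ↥(box 4 R)
  /-- the site of `ψ` -/
  tgt : ↥(box 4 R)
  /-- the colour matrix, a function of the `ℤ⁴` gauge field -/
  W : LGConfig 4 𝔾 → Matrix (Fin 3) (Fin 3) ℂ
  /-- a finite set of links on which `W` depends -/
  supp : Finset (ZdEdge 4)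
  isCylinder : IsCylinder W supp
  /-- gauge covariance `W(U^g) = g(src) W(U) g(tgt)⁻¹` -/
  covariant : ∀ (g : LatticeModels.Site 4 → 𝔾) (U : LGConfig 4 𝔾),
    W (gaugeTransformZd g U) =
      ((g src : 𝔾) : Matrix (Fin 3) (Fin 3) ℂ) * W U * (((g tgt)⁻¹ : 𝔾) : Matrix (Fin 3) (Fin 3) ℂ)
  /-- the entries are bounded … -/
  bounded : ∃ C : ℝ, ∀ U a b, ‖W U a b‖ ≤ C
  /-- … and measurable in the gauge field -/
  measurable : ∀ a b, Measurable fun U => W U a b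

namespace QuarkTransporter

/-- **The unit transporter at a site** (`W = 1`, `src = tgt = x`): local bilinears `ψ̄(x) Γ ψ(x)`. [folklore] -/
def refl (x : ↥(box 4 R)) : QuarkTransporter R where
  src := x
  tgt := x
  W := fun _ => 1
  supp := ∅
  isCylinder := fun _ _ _ => rfl
  covariant g U := by rw [Matrix.mul_one, specialUnitary_coe_mul_coe_inv]
  bounded := ⟨1, fun U a b => by
    rw [Matrix.one_apply]
    split_ifs <;> simp⟩
  measurable := fun _ _ => measurable_const

/-- **The link transporter** `W(U) = U(x,μ)` (`src = x`, `tgt = x + μ̂`; in the tree's orientation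
`U(x,μ) ↦ g(x) U(x,μ) g(x+μ̂)⁻¹` the link carries colour from `x + μ̂` to `x`): the forward hopping
bilinear `ψ̄(x) Γ U(x,μ) ψ(x+μ̂)` of the Wilson action. [cite: MontvayMunster1994, §5.1.1 (5.4)–(5.5)] -/
def link (x : ↥(box 4 R)) (μ : Fin 4) (h : (x : LatticeModels.Site 4) + Pi.single μ 1 ∈ box 4 R) :
    QuarkTransporter R where
  src := x
  tgt := ⟨(x : LatticeModels.Site 4) + Pi.single μ 1, h⟩
  W U := ((U ((x : LatticeModels.Site 4), μ) : 𝔾) : Matrix (Fin 3) (Fin 3) ℂ)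
  supp := {((x : LatticeModels.Site 4), μ)}
  isCylinder U V hUV := by
    beta_reduce
    rw [hUV ((x : LatticeModels.Site 4), μ) (by simp)]
  covariant g U := by simp only [gaugeTransformZd, Submonoid.coe_mul]
  bounded := ⟨1, fun U a b =>
    entry_norm_bound_of_unitary (Matrix.specialUnitaryGroup_le_unitaryGroup (U _).2) a b⟩
  measurable a b :=
    (continuous_subtype_val.matrix_elem a b).measurable.comp (measurable_pi_apply _)

/-- **The reversed link transporter** `W(U) = U(x,μ)⁻¹` (`src = x + μ̂`, `tgt = x`): the backward
hopping bilinear `ψ̄(x+μ̂) Γ U(x,μ)⁻¹ ψ(x)` of the Wilson action. [cite: MontvayMunster1994, §5.1.1 (5.4)–(5.5)] -/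
def linkInv (x : ↥(box 4 R)) (μ : Fin 4) (h : (x : LatticeModels.Site 4) + Pi.single μ 1 ∈ box 4 R) :
    QuarkTransporter R where
  src := ⟨(x : LatticeModels.Site 4) + Pi.single μ 1, h⟩
  tgt := x
  W U := (((U ((x : LatticeModels.Site 4), μ))⁻¹ : 𝔾) : Matrix (Fin 3) (Fin 3) ℂ)
  supp := {((x : LatticeModels.Site 4), μ)}
  isCylinder U V hUV := by
    beta_reduce
    rw [hUV ((x : LatticeModels.Site 4), μ) (by simp)]
  covariant g U := by simp only [gaugeTransformZd, mul_inv_rev, inv_inv, Submonoid.coe_mul, mul_assoc]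
  bounded := ⟨1, fun U a b =>
    entry_norm_bound_of_unitary (Matrix.specialUnitaryGroup_le_unitaryGroup ((U _)⁻¹).2) a b⟩
  measurable a b :=
    ((continuous_subtype_val.comp continuous_inv).matrix_elem a b).measurable.comp
      (measurable_pi_apply _)

/-- The unit transporter reads no link. [folklore] -/
@[simp] theorem refl_supp (x : ↥(box 4 R)) : (refl x).supp = ∅ := rfl

/-- The link transporter reads the one link `(x, μ)`. [folklore] -/
@[simp] theorem link_supp (x : ↥(box 4 R)) (μ : Fin 4)
    (h : (x : LatticeModels.Site 4) + Pi.single μ 1 ∈ box 4 R) :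
    (link x μ h).supp = {((x : LatticeModels.Site 4), μ)} := rfl

/-- The reversed link transporter reads the one link `(x, μ)`. [folklore] -/
@[simp] theorem linkInv_supp (x : ↥(box 4 R)) (μ : Fin 4)
    (h : (x : LatticeModels.Site 4) + Pi.single μ 1 ∈ box 4 R) :
    (linkInv x μ h).supp = {((x : LatticeModels.Site 4), μ)} := rfl

/-- Endpoints of the unit transporter. [folklore] -/
@[simp] theorem refl_src (x : ↥(box 4 R)) : (refl x).src = x := rfl

/-- Endpoints of the unit transporter. [folklore] -/
@[simp] theorem refl_tgt (x : ↥(box 4 R)) : (refl x).tgt = x := rfl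

/-- Endpoints of the link transporter. [folklore] -/
@[simp] theorem link_src (x : ↥(box 4 R)) (μ : Fin 4)
    (h : (x : LatticeModels.Site 4) + Pi.single μ 1 ∈ box 4 R) : (link x μ h).src = x := rfl

/-- Endpoints of the link transporter. [folklore] -/
@[simp] theorem link_tgt (x : ↥(box 4 R)) (μ : Fin 4)
    (h : (x : LatticeModels.Site 4) + Pi.single μ 1 ∈ box 4 R) :
    (link x μ h).tgt = ⟨(x : LatticeModels.Site 4) + Pi.single μ 1, h⟩ := rfl

/-- Endpoints of the reversed link transporter. [folklore] -/
@[simp] theorem linkInv_src (x : ↥(box 4 R)) (μ : Fin 4)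
    (h : (x : LatticeModels.Site 4) + Pi.single μ 1 ∈ box 4 R) :
    (linkInv x μ h).src = ⟨(x : LatticeModels.Site 4) + Pi.single μ 1, h⟩ := rfl

/-- Endpoints of the reversed link transporter. [folklore] -/
@[simp] theorem linkInv_tgt (x : ↥(box 4 R)) (μ : Fin 4)
    (h : (x : LatticeModels.Site 4) + Pi.single μ 1 ∈ box 4 R) : (linkInv x μ h).tgt = x := rfl

/-- The unit transporter, unfolded. [folklore] -/
@[simp] theorem refl_W (x : ↥(box 4 R)) (U : LGConfig 4 𝔾) : (refl x).W U = 1 := rfl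

/-- The link transporter, unfolded. [folklore] -/
@[simp] theorem link_W (x : ↥(box 4 R)) (μ : Fin 4)
    (h : (x : LatticeModels.Site 4) + Pi.single μ 1 ∈ box 4 R) (U : LGConfig 4 𝔾) :
    (link x μ h).W U = ((U ((x : LatticeModels.Site 4), μ) : 𝔾) : Matrix (Fin 3) (Fin 3) ℂ) := rfl

/-- The reversed link transporter, unfolded. [folklore] -/
@[simp] theorem linkInv_W (x : ↥(box 4 R)) (μ : Fin 4)
    (h : (x : LatticeModels.Site 4) + Pi.single μ 1 ∈ box 4 R) (U : LGConfig 4 𝔾) :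
    (linkInv x μ h).W U = (((U ((x : LatticeModels.Site 4), μ))⁻¹ : 𝔾) : Matrix (Fin 3) (Fin 3) ℂ) :=
  rfl

end QuarkTransporter

namespace QCDLatticeObservable

/-- **The gauge-invariant quark bilinear with flavour matrix `T`, spin matrix `Γ` and transporter
`τ`** as a local lattice QCD observable: `U ↦ ∑_{f,g} T_{fg} ψ̄_f(src) Γ W(U) ψ_g(tgt)` — cylinder on
the links of `W`, jointly gauge invariant (`fermiGaugeAct_boxBilinear` with the covariance of
`W`), with bounded measurable Berezin coefficients. Covers the local densities `ψ̄ Γ (λ/2) ψ`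
((5.151), (5.153)) and the two hopping halves of the point-split currents (5.149), (5.152). [cite: MontvayMunster1994, §5.3.1 (5.149)–(5.153)] [cite: OsterwalderSeiler1978, §2] -/
def bilinearObs (τ : QuarkTransporter R) (T : Matrix (Fin Nf) (Fin Nf) ℂ)
    (Γ : Matrix (Fin 4) (Fin 4) ℂ) : QCDLatticeObservable Nf R where
  F U := ∑ f : Fin Nf, ∑ g : Fin Nf, T f g • boxBilinear f g τ.src τ.tgt Γ (τ.W U)
  supp := τ.supp
  isCylinder U V hUV := by
    change (∑ f : Fin Nf, ∑ g : Fin Nf, T f g • boxBilinear f g τ.src τ.tgt Γ (τ.W U)) =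
      ∑ f : Fin Nf, ∑ g : Fin Nf, T f g • boxBilinear f g τ.src τ.tgt Γ (τ.W V)
    rw [τ.isCylinder hUV]
  gaugeInvariant u U := by
    have hW : (((u τ.src)⁻¹ : 𝔾) : Matrix (Fin 3) (Fin 3) ℂ) * τ.W (gaugeTransformZd u U) *
        ((u τ.tgt : 𝔾) : Matrix (Fin 3) (Fin 3) ℂ) = τ.W U := by
      rw [τ.covariant, Matrix.mul_assoc, Matrix.mul_assoc, specialUnitary_coe_inv_mul_coe,
        Matrix.mul_one, ← Matrix.mul_assoc, specialUnitary_coe_inv_mul_coe, Matrix.one_mul]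
    change fermiGaugeAct u (∑ f : Fin Nf, ∑ g : Fin Nf,
      T f g • boxBilinear f g τ.src τ.tgt Γ (τ.W (gaugeTransformZd u U))) = _
    simp only [map_sum, map_smul, fermiGaugeAct_boxBilinear, hW]
  bounded y := by
    obtain ⟨C, hC⟩ := τ.bounded
    refine ⟨∑ f : Fin Nf, ∑ g : Fin Nf, ∑ α : Fin 4, ∑ β : Fin 4, ∑ a : Fin 3, ∑ b : Fin 3,
      ‖T f g‖ * (‖Γ α β‖ * C) *
        ‖GrassmannAlgebra.berezin ℂ (BoxFermiIdx Nf R ⊕ₗ BoxFermiIdx Nf R)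
          (boxQbar (f, (τ.src, a, α)) * boxQ (g, (τ.tgt, b, β)) * y)‖, fun U => ?_⟩
    simp only [boxBilinear, Finset.smul_sum, smul_smul, Finset.sum_mul, smul_mul_assoc, map_sum,
      map_smul, smul_eq_mul]
    refine (norm_sum_le _ _).trans (Finset.sum_le_sum fun f _ => ?_)
    refine (norm_sum_le _ _).trans (Finset.sum_le_sum fun g _ => ?_)
    refine (norm_sum_le _ _).trans (Finset.sum_le_sum fun α _ => ?_)
    refine (norm_sum_le _ _).trans (Finset.sum_le_sum fun β _ => ?_)
    refine (norm_sum_le _ _).trans (Finset.sum_le_sum fun a _ => ?_)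
    refine (norm_sum_le _ _).trans (Finset.sum_le_sum fun b _ => ?_)
    rw [norm_mul, norm_mul, norm_mul]
    gcongr
    exact hC U a b
  measurable y := by
    simp only [boxBilinear, Finset.smul_sum, smul_smul, Finset.sum_mul, smul_mul_assoc, map_sum,
      map_smul, smul_eq_mul]
    refine Finset.measurable_sum _ fun f _ => Finset.measurable_sum _ fun g _ =>
      Finset.measurable_sum _ fun α _ => Finset.measurable_sum _ fun β _ =>
      Finset.measurable_sum _ fun a _ => Finset.measurable_sum _ fun b _ => ?_
    exact (measurable_const.mul (measurable_const.mul (τ.measurable a b))).mul_const _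

/-- The bilinear observable, unfolded. [folklore] -/
@[simp] theorem bilinearObs_F (τ : QuarkTransporter R) (T : Matrix (Fin Nf) (Fin Nf) ℂ)
    (Γ : Matrix (Fin 4) (Fin 4) ℂ) (U : LGConfig 4 𝔾) :
    (bilinearObs τ T Γ).F U = ∑ f : Fin Nf, ∑ g : Fin Nf, T f g • boxBilinear f g τ.src τ.tgt Γ (τ.W U) :=
  rfl

/-- The link support of the bilinear observable is that of its transporter. [folklore] -/
@[simp] theorem bilinearObs_supp (τ : QuarkTransporter R) (T : Matrix (Fin Nf) (Fin Nf) ℂ)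
    (Γ : Matrix (Fin 4) (Fin 4) ℂ) : (bilinearObs (Nf := Nf) τ T Γ).supp = τ.supp := rfl

/-! #### Linear structure on local observables -/

/-- Sum of two local observables with the same quark box (pointwise in the Grassmann algebra; link
support the union). [folklore] -/
instance instAdd : Add (QCDLatticeObservable Nf R) where
  add A B :=
    { F := fun U => A.F U + B.F U
      supp := A.supp ∪ B.supp
      isCylinder := fun U V hUV => by
        change A.F U + B.F U = A.F V + B.F V
        rw [A.isCylinder fun e he => hUV e (Finset.mem_union_left _ he),
          B.isCylinder fun e he => hUV e (Finset.mem_union_right _ he)]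
      gaugeInvariant := fun g U => by rw [map_add, A.gaugeInvariant, B.gaugeInvariant]
      bounded := fun y => by
        obtain ⟨C, hC⟩ := A.bounded y
        obtain ⟨D, hD⟩ := B.bounded y
        exact ⟨C + D, fun U => by
          rw [add_mul, map_add]
          exact (norm_add_le _ _).trans (add_le_add (hC U) (hD U))⟩
      measurable := fun y => by
        simp only [add_mul, map_add]
        exact (A.measurable y).add (B.measurable y) }

/-- Complex multiple of a local observable. [folklore] -/
instance instSMul : SMul ℂ (QCDLatticeObservable Nf R) where
  smul c A :=
    { F := fun U => c • A.F U
      supp := A.supp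
      isCylinder := fun U V hUV => by
        change c • A.F U = c • A.F V
        rw [A.isCylinder hUV]
      gaugeInvariant := fun g U => by rw [map_smul, A.gaugeInvariant]
      bounded := fun y => by
        obtain ⟨C, hC⟩ := A.bounded y
        exact ⟨‖c‖ * C, fun U => by
          rw [smul_mul_assoc, map_smul, norm_smul]
          exact mul_le_mul_of_nonneg_left (hC U) (norm_nonneg _)⟩
      measurable := fun y => by
        simp only [smul_mul_assoc, map_smul, smul_eq_mul]
        exact (A.measurable y).const_mul _ }

/-- Negative of a local observable. [folklore] -/
instance instNeg : Neg (QCDLatticeObservable Nf R) := ⟨fun A => (-1 : ℂ) • A⟩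

/-- Difference of two local observables. [folklore] -/
instance instSub : Sub (QCDLatticeObservable Nf R) := ⟨fun A B => A + -B⟩

/-- The sum, unfolded. [folklore] -/
@[simp] theorem add_F (A B : QCDLatticeObservable Nf R) (U : LGConfig 4 𝔾) :
    (A + B).F U = A.F U + B.F U := rfl

/-- The support of a sum. [folklore] -/
@[simp] theorem add_supp (A B : QCDLatticeObservable Nf R) : (A + B).supp = A.supp ∪ B.supp := rfl

/-- The multiple, unfolded. [folklore] -/
@[simp] theorem smul_F (c : ℂ) (A : QCDLatticeObservable Nf R) (U : LGConfig 4 𝔾) :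
    (c • A).F U = c • A.F U := rfl

/-- The support of a multiple. [folklore] -/
@[simp] theorem smul_supp (c : ℂ) (A : QCDLatticeObservable Nf R) : (c • A).supp = A.supp := rfl

/-- The support of a negative. [folklore] -/
@[simp] theorem neg_supp (A : QCDLatticeObservable Nf R) : (-A).supp = A.supp := rfl

/-- The support of a difference. [folklore] -/
@[simp] theorem sub_supp (A B : QCDLatticeObservable Nf R) : (A - B).supp = A.supp ∪ B.supp := rfl

/-- The negative, unfolded. [folklore] -/
@[simp] theorem neg_F (A : QCDLatticeObservable Nf R) (U : LGConfig 4 𝔾) : (-A).F U = -A.F U := by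
  change (-1 : ℂ) • A.F U = -A.F U
  rw [neg_one_smul]

/-- The difference, unfolded. [folklore] -/
@[simp] theorem sub_F (A B : QCDLatticeObservable Nf R) (U : LGConfig 4 𝔾) :
    (A - B).F U = A.F U - B.F U := by
  change A.F U + (-1 : ℂ) • B.F U = A.F U - B.F U
  rw [neg_one_smul, sub_eq_add_neg]

end QCDLatticeObservable

end Transporter

/-! ### The named currents and densities at the origin -/

section Currents

open QCDLatticeObservable

/-- The origin of the quark box. [folklore] -/
def boxOrigin (R : ℕ) : ↥(box 4 R) := ⟨0, zero_mem_box 4 R⟩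

/-- The underlying site of the box origin. [folklore] -/
@[simp] theorem coe_boxOrigin (R : ℕ) : ((boxOrigin R : ↥(box 4 R)) : LatticeModels.Site 4) = 0 := rfl

/-- The unit step `μ̂` lies in the quark box of radius `1`. [folklore] -/
theorem single_mem_box_one (μ : Fin 4) :
    ((boxOrigin 1 : ↥(box 4 1)) : LatticeModels.Site 4) + Pi.single μ 1 ∈ box 4 1 := by
  rw [coe_boxOrigin, zero_add, mem_box]
  intro i
  by_cases h : i = μ
  · subst h; simp
  · simp [h]

variable (Nf)

/-- **The local quark density `ψ̄(x) Γ T ψ(x) = ∑_{f,g,a,α,β} T_{fg} Γ_{αβ} ψ̄_{f,x,a,α} ψ_{g,x,a,β}`**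
with flavour matrix `T` and spin matrix `Γ` (colour singlet, unit transporter): the local
currents and densities `V^loc`, `A^loc`, `P`, `S` of Montvay–Münster (5.151), (5.153) (`T = λ_S/2`). [cite: MontvayMunster1994, §5.3.1 (5.151) and (5.153)] -/
def localBilinearObs {R : ℕ} (x : ↥(box 4 R)) (T : Matrix (Fin Nf) (Fin Nf) ℂ)
    (Γ : Matrix (Fin 4) (Fin 4) ℂ) : QCDLatticeObservable Nf R :=
  bilinearObs (QuarkTransporter.refl x) T Γ

/-- **The conserved point-split Wilson vector current at the origin** with flavour matrix `T`
(Montvay–Münster (5.149) at `r = 1`, `a = 1`; Karsten–Smit's conserved current; (4.255) for one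
flavour), in the tree's link orientation (`U_tree(0,μ) = U_MM(0,μ)⁺`, see the module docstring):
`V_μ(0) = ½ [ψ̄(μ̂) (1 + γ_μ) U(0,μ)⁻¹ T ψ(0) − ψ̄(0) (1 − γ_μ) U(0,μ) T ψ(μ̂)]`, quark box `R = 1`.
It is the Noether current of the vector flavour rotation generated by `T`; for `T` commuting with
the (diagonal) bare mass matrix — every diagonal `T`, in particular the single-flavour projector —
its backward divergence `∑_μ (V_μ(x) − V_μ(x − μ̂))` vanishes inside expectations up to contact
terms (the exact lattice Ward identity (5.150)). [cite: MontvayMunster1994, §5.3.1 (5.149)–(5.150) and §4.4.2 (4.254)–(4.255)] [cite: KarstenSmit1981] -/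
def conservedVectorCurrent (T : Matrix (Fin Nf) (Fin Nf) ℂ) (μ : Fin 4) : QCDLatticeObservable Nf 1 :=
  (1 / 2 : ℂ) •
    (bilinearObs (QuarkTransporter.linkInv (boxOrigin 1) μ (single_mem_box_one μ)) T
        (1 + euclideanGamma μ) -
      bilinearObs (QuarkTransporter.link (boxOrigin 1) μ (single_mem_box_one μ)) T
        (1 - euclideanGamma μ))

/-- **The conserved vector current of ONE flavour `f`**, `V^{(f)}_μ(0)`: `conservedVectorCurrent` with the
flavour projector `T = E_{ff}` (Montvay–Münster (4.255) for the flavour-`f` quark; the flavour-singlet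
conserved current of §5.3.3 is `∑_f V^{(f)}`). [cite: MontvayMunster1994, §4.4.2 (4.255) and §5.3.1 (5.149)] -/
def conservedVectorCurrentOfFlavour (f : Fin Nf) (μ : Fin 4) : QCDLatticeObservable Nf 1 :=
  conservedVectorCurrent Nf (Matrix.single f f 1) μ

/-- **The local axial vector current at the origin**, `A_μ(0) = ψ̄(0) γ_μ γ₅ T ψ(0)` with flavour
matrix `T` (Montvay–Münster (5.151), `A^loc_{Sxμ}` with `T = λ_S/2`; quark box `R = 1` to sit next to
`conservedVectorCurrent`). [cite: MontvayMunster1994, §5.3.1 (5.151)] -/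
def axialCurrentObs (T : Matrix (Fin Nf) (Fin Nf) ℂ) (μ : Fin 4) : QCDLatticeObservable Nf 1 :=
  localBilinearObs Nf (boxOrigin 1) T (euclideanGamma μ * gammaFive)

/-- **The pseudoscalar density at the origin**, `P(0) = ψ̄(0) γ₅ T ψ(0)` with flavour matrix `T` —
the density on the right-hand side of the axial Ward identities, Montvay–Münster (4.260)–(4.261)
(`2am ψ̄_x γ₅ ψ_x`) and (5.155) (`ψ̄_x γ₅ {am, λ_S/2} ψ_x`). (`QCDOS.pseudoscalarBilinear` is the
hermitian `ψ̄ iγ₅ ψ = i · P` on the torus.) [cite: MontvayMunster1994, §4.4.2 (4.260)–(4.261) and §5.3.1 (5.155)] -/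
def pseudoscalarDensityObs (T : Matrix (Fin Nf) (Fin Nf) ℂ) : QCDLatticeObservable Nf 1 :=
  localBilinearObs Nf (boxOrigin 1) T gammaFive

variable {Nf}

/-- The local density, unfolded. [folklore] -/
theorem localBilinearObs_F {R : ℕ} (x : ↥(box 4 R)) (T : Matrix (Fin Nf) (Fin Nf) ℂ)
    (Γ : Matrix (Fin 4) (Fin 4) ℂ) (U : LGConfig 4 𝔾) :
    (localBilinearObs Nf x T Γ).F U = ∑ f : Fin Nf, ∑ g : Fin Nf, T f g • boxBilinear f g x x Γ 1 := rfl

/-- The local density reads no link. [folklore] -/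
@[simp] theorem localBilinearObs_supp {R : ℕ} (x : ↥(box 4 R)) (T : Matrix (Fin Nf) (Fin Nf) ℂ)
    (Γ : Matrix (Fin 4) (Fin 4) ℂ) : (localBilinearObs Nf x T Γ).supp = ∅ := rfl

/-- **The conserved vector current, unfolded** into the two hopping halves of (5.149):
`½ [ψ̄(μ̂)(1+γ_μ)U(0,μ)⁻¹Tψ(0) − ψ̄(0)(1−γ_μ)U(0,μ)Tψ(μ̂)]`. [cite: MontvayMunster1994, §5.3.1 (5.149)] -/
theorem conservedVectorCurrent_F (T : Matrix (Fin Nf) (Fin Nf) ℂ) (μ : Fin 4) (U : LGConfig 4 𝔾) :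
    (conservedVectorCurrent Nf T μ).F U =
      (1 / 2 : ℂ) •
        ((∑ f : Fin Nf, ∑ g : Fin Nf, T f g •
            boxBilinear f g ⟨(0 : LatticeModels.Site 4) + Pi.single μ 1, single_mem_box_one μ⟩
              (boxOrigin 1) (1 + euclideanGamma μ)
              (((U ((0 : LatticeModels.Site 4), μ))⁻¹ : 𝔾) : Matrix (Fin 3) (Fin 3) ℂ)) -
          ∑ f : Fin Nf, ∑ g : Fin Nf, T f g •
            boxBilinear f g (boxOrigin 1)
              ⟨(0 : LatticeModels.Site 4) + Pi.single μ 1, single_mem_box_one μ⟩ (1 - euclideanGamma μ)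
              ((U ((0 : LatticeModels.Site 4), μ) : 𝔾) : Matrix (Fin 3) (Fin 3) ℂ)) := by
  simp only [conservedVectorCurrent, smul_F, sub_F]
  rfl

/-- The conserved vector current reads the single link `(0, μ)`. [folklore] -/
theorem conservedVectorCurrent_supp (T : Matrix (Fin Nf) (Fin Nf) ℂ) (μ : Fin 4) :
    (conservedVectorCurrent Nf T μ).supp = {((0 : LatticeModels.Site 4), μ)} := by
  simp [conservedVectorCurrent]

/-- The axial current, unfolded: `ψ̄(0) γ_μγ₅ T ψ(0)`. [cite: MontvayMunster1994, §5.3.1 (5.151)] -/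
theorem axialCurrentObs_F (T : Matrix (Fin Nf) (Fin Nf) ℂ) (μ : Fin 4) (U : LGConfig 4 𝔾) :
    (axialCurrentObs Nf T μ).F U =
      ∑ f : Fin Nf, ∑ g : Fin Nf, T f g •
        boxBilinear f g (boxOrigin 1) (boxOrigin 1) (euclideanGamma μ * gammaFive) 1 := rfl

/-- The pseudoscalar density, unfolded: `ψ̄(0) γ₅ T ψ(0)`. [cite: MontvayMunster1994, §5.3.1 (5.155)] -/
theorem pseudoscalarDensityObs_F (T : Matrix (Fin Nf) (Fin Nf) ℂ) (U : LGConfig 4 𝔾) :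
    (pseudoscalarDensityObs Nf T).F U =
      ∑ f : Fin Nf, ∑ g : Fin Nf, T f g • boxBilinear f g (boxOrigin 1) (boxOrigin 1) gammaFive 1 := rfl

end Currents

/-! ### Placing the bilinears on the torus -/

section OnTorus

variable {S : ℕ} [NeZero S]

/-- **The quark bilinear on the torus of side `S`**:
`ψ̄_f(x) Γ M ψ_g(y) = ∑_{α,β,a,b} Γ_{αβ} M_{ab} ψ̄_{f,x,a,α} ψ_{g,y,b,β}` in the torus quark variables
`qbar`, `q` of `QCDOS` (the image of `boxBilinear` under `onTorus`). [cite: MontvayMunster1994, §5.3.1 (5.149)–(5.153)] -/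
def torusBilinear (f g : Fin Nf) (x y : TorusSite 4 S) (Γ : Matrix (Fin 4) (Fin 4) ℂ)
    (M : Matrix (Fin 3) (Fin 3) ℂ) : FermiAlg Nf S :=
  ∑ α : Fin 4, ∑ β : Fin 4, ∑ a : Fin 3, ∑ b : Fin 3,
    (Γ α β * M a b) • (qbar (f, (x, a, α)) * q (g, (y, b, β)))

/-- **Consistency with the tree's local torus bilinear** (`FermionFlow.quarkBilinear`,
`ψ̄_r(x) Γ ψ_s(x)`): the torus bilinear with unit colour matrix at coincident sites. [folklore] -/
theorem torusBilinear_one (f g : Fin Nf) (x : TorusSite 4 S) (Γ : Matrix (Fin 4) (Fin 4) ℂ) :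
    torusBilinear f g x x Γ 1 = quarkBilinear Γ f g x := by
  simp only [torusBilinear, quarkBilinear, Matrix.one_apply, mul_ite, mul_one, mul_zero, ite_smul,
    zero_smul, Finset.sum_ite_eq, Finset.mem_univ, if_true]
  exact (Finset.sum_congr rfl fun _ _ => Finset.sum_comm).trans Finset.sum_comm

/-- Placing `ψ̄_{f,x,a,α}` at `v` on the torus gives the torus variable `ψ̄_{f, x+v mod S, a, α}`. [folklore] -/
theorem map_place_boxQbar (v : LatticeModels.Site 4) (f : Fin Nf) (x : ↥(box 4 R)) (a : Fin 3)
    (α : Fin 4) :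
    ExteriorAlgebra.map (Fintype.linearCombination ℂ fun w =>
        Pi.single (QCDLatticeObservable.toTorusIdx (Nf := Nf) (R := R) S v w) (1 : ℂ))
      (boxQbar (f, (x, a, α))) =
      qbar (f, (Torus.proj S ((x : LatticeModels.Site 4) + v), a, α)) := by
  classical
  simp only [boxQbar, psiBar, GrassmannAlgebra.gen, ExteriorAlgebra.map_apply_ι,
    Fintype.linearCombination_apply_single, one_smul, QCDLatticeObservable.toTorusIdx, ofLex_toLex,
    Equiv.symm_apply_apply, qbar]

/-- Placing `ψ_{f,x,a,α}` at `v` on the torus gives the torus variable `ψ_{f, x+v mod S, a, α}`. [folklore] -/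
theorem map_place_boxQ (v : LatticeModels.Site 4) (f : Fin Nf) (x : ↥(box 4 R)) (a : Fin 3)
    (α : Fin 4) :
    ExteriorAlgebra.map (Fintype.linearCombination ℂ fun w =>
        Pi.single (QCDLatticeObservable.toTorusIdx (Nf := Nf) (R := R) S v w) (1 : ℂ))
      (boxQ (f, (x, a, α))) =
      q (f, (Torus.proj S ((x : LatticeModels.Site 4) + v), a, α)) := by
  classical
  simp only [boxQ, psi, GrassmannAlgebra.gen, ExteriorAlgebra.map_apply_ι,
    Fintype.linearCombination_apply_single, one_smul, QCDLatticeObservable.toTorusIdx, ofLex_toLex,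
    Equiv.symm_apply_apply, q]

namespace QCDLatticeObservable

/-- **The bilinear observable placed at `v` on the torus** is the torus bilinear between the
translated sites, with the transporter read from the translated periodic gauge field. [cite: OsterwalderSeiler1978, §2] -/
theorem bilinearObs_onTorus (τ : QuarkTransporter R) (T : Matrix (Fin Nf) (Fin Nf) ℂ)
    (Γ : Matrix (Fin 4) (Fin 4) ℂ) (v : LatticeModels.Site 4) (U : GaugeConfig 4 S 𝔾) :
    (bilinearObs τ T Γ).onTorus S v U =
      ∑ f : Fin Nf, ∑ g : Fin Nf, T f g •
        torusBilinear f g (Torus.proj S ((τ.src : LatticeModels.Site 4) + v))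
          (Torus.proj S ((τ.tgt : LatticeModels.Site 4) + v)) Γ (τ.W (configShift (-v) (torusLift S U))) := by
  simp only [onTorus, bilinearObs_F, boxBilinear, torusBilinear, map_sum, map_smul, map_mul,
    map_place_boxQbar, map_place_boxQ]

/-- `onTorus` is additive. [folklore] -/
@[simp] theorem add_onTorus (A B : QCDLatticeObservable Nf R) (v : LatticeModels.Site 4)
    (U : GaugeConfig 4 S 𝔾) : (A + B).onTorus S v U = A.onTorus S v U + B.onTorus S v U := by
  simp only [onTorus, add_F, map_add]

/-- `onTorus` is homogeneous. [folklore] -/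
@[simp] theorem smul_onTorus (c : ℂ) (A : QCDLatticeObservable Nf R) (v : LatticeModels.Site 4)
    (U : GaugeConfig 4 S 𝔾) : (c • A).onTorus S v U = c • A.onTorus S v U := by
  simp only [onTorus, smul_F, map_smul]

/-- `onTorus` of a negative. [folklore] -/
@[simp] theorem neg_onTorus (A : QCDLatticeObservable Nf R) (v : LatticeModels.Site 4)
    (U : GaugeConfig 4 S 𝔾) : (-A).onTorus S v U = -A.onTorus S v U := by
  simp only [onTorus, neg_F, map_neg]

/-- `onTorus` of a difference. [folklore] -/
@[simp] theorem sub_onTorus (A B : QCDLatticeObservable Nf R) (v : LatticeModels.Site 4)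
    (U : GaugeConfig 4 S 𝔾) : (A - B).onTorus S v U = A.onTorus S v U - B.onTorus S v U := by
  simp only [onTorus, sub_F, map_sub]

end QCDLatticeObservable

namespace QuarkTransporter

omit [NeZero S] in
/-- The link transporter read from the translated periodic field is the torus link at `x + v`. [folklore] -/
@[simp] theorem link_W_configShift_torusLift (x : ↥(box 4 R)) (μ : Fin 4)
    (h : (x : LatticeModels.Site 4) + Pi.single μ 1 ∈ box 4 R) (v : LatticeModels.Site 4)
    (U : GaugeConfig 4 S 𝔾) :
    (link x μ h).W (configShift (-v) (torusLift S U)) =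
      ((U (Torus.proj S ((x : LatticeModels.Site 4) + v), μ) : 𝔾) : Matrix (Fin 3) (Fin 3) ℂ) := by
  simp [link, torusLift, torusEdge]

omit [NeZero S] in
/-- The reversed link transporter read from the translated periodic field. [folklore] -/
@[simp] theorem linkInv_W_configShift_torusLift (x : ↥(box 4 R)) (μ : Fin 4)
    (h : (x : LatticeModels.Site 4) + Pi.single μ 1 ∈ box 4 R) (v : LatticeModels.Site 4)
    (U : GaugeConfig 4 S 𝔾) :
    (linkInv x μ h).W (configShift (-v) (torusLift S U)) =
      (((U (Torus.proj S ((x : LatticeModels.Site 4) + v), μ))⁻¹ : 𝔾) : Matrix (Fin 3) (Fin 3) ℂ) := by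
  simp [linkInv, torusLift, torusEdge]

end QuarkTransporter

/-- **The conserved vector current placed at `v` on the torus**:
`½ [ψ̄(v+μ̂)(1+γ_μ)U(v,μ)⁻¹ T ψ(v) − ψ̄(v)(1−γ_μ)U(v,μ) T ψ(v+μ̂)]` in torus variables (sites mod `S`). [cite: MontvayMunster1994, §5.3.1 (5.149)] -/
theorem conservedVectorCurrent_onTorus (T : Matrix (Fin Nf) (Fin Nf) ℂ) (μ : Fin 4) (v : LatticeModels.Site 4)
    (U : GaugeConfig 4 S 𝔾) :
    (conservedVectorCurrent Nf T μ).onTorus S v U =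
      (1 / 2 : ℂ) •
        ((∑ f : Fin Nf, ∑ g : Fin Nf, T f g •
            torusBilinear f g (Torus.proj S (Pi.single μ 1 + v)) (Torus.proj S v) (1 + euclideanGamma μ)
              (((U (Torus.proj S v, μ))⁻¹ : 𝔾) : Matrix (Fin 3) (Fin 3) ℂ)) -
          ∑ f : Fin Nf, ∑ g : Fin Nf, T f g •
            torusBilinear f g (Torus.proj S v) (Torus.proj S (Pi.single μ 1 + v)) (1 - euclideanGamma μ)
              ((U (Torus.proj S v, μ) : 𝔾) : Matrix (Fin 3) (Fin 3) ℂ)) := by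
  simp only [conservedVectorCurrent, QCDLatticeObservable.smul_onTorus, QCDLatticeObservable.sub_onTorus,
    QCDLatticeObservable.bilinearObs_onTorus, QuarkTransporter.link_W_configShift_torusLift,
    QuarkTransporter.linkInv_W_configShift_torusLift, QuarkTransporter.link_src,
    QuarkTransporter.link_tgt, QuarkTransporter.linkInv_src, QuarkTransporter.linkInv_tgt,
    coe_boxOrigin, zero_add]

/-- **A local density placed at `v` on the torus**: `ψ̄(x+v) Γ T ψ(x+v)` in torus variables. [cite: MontvayMunster1994, §5.3.1 (5.151)] -/
theorem localBilinearObs_onTorus (x : ↥(box 4 R)) (T : Matrix (Fin Nf) (Fin Nf) ℂ)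
    (Γ : Matrix (Fin 4) (Fin 4) ℂ) (v : LatticeModels.Site 4) (U : GaugeConfig 4 S 𝔾) :
    (localBilinearObs Nf x T Γ).onTorus S v U =
      ∑ f : Fin Nf, ∑ g : Fin Nf, T f g •
        torusBilinear f g (Torus.proj S ((x : LatticeModels.Site 4) + v))
          (Torus.proj S ((x : LatticeModels.Site 4) + v)) Γ 1 := by
  simp only [localBilinearObs, QCDLatticeObservable.bilinearObs_onTorus, QuarkTransporter.refl_W]
  rfl

end OnTorus

/-! ### Three-point functions on the torus and their physical-momentum transform -/

section ThreePoint

variable {R₁ R₂ R₃ : ℕ}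

/-- **The three-point function `⟨X(x) Y(y) Z(0)⟩_{β, 2S+1, m}`** of three gauge-invariant local
observables placed at `x`, `y` and the origin of the torus of side `2S+1`, at inverse bare coupling
`β` and bare masses `m_f` (`qcdTorusExpect`, signed fermion determinant). [cite: MontvayMunster1994, §5.3.1 (5.146)] [cite: OsterwalderSeiler1978, §2] -/
def qcdThreePoint (β : ℝ) (S : ℕ) (mq : Fin Nf → ℝ) (X : QCDLatticeObservable Nf R₁)
    (Y : QCDLatticeObservable Nf R₂) (Z : QCDLatticeObservable Nf R₃) (x y : LatticeModels.Site 4) : ℂ :=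
  qcdTorusExpect β (2 * S + 1) mq fun U =>
    X.onTorus (2 * S + 1) x U * Y.onTorus (2 * S + 1) y U * Z.onTorus (2 * S + 1) 0 U

/-- **The physical-momentum torus transform of a three-point function** at lattice spacing `a`:
`a⁸ ∑_{x,y ∈ {−S,…,S}⁴} e^{i a (p·x + q·y)} ⟨X(x) Y(y) Z(0)⟩_{β,2S+1,m}` (`p`, `q` physical momenta,
`a x`, `a y` physical positions; the box is a fundamental domain of the torus). Its `k → ∞` limits
along a scheme are the momentum-space three-point functions `Γ(p, q)` of the Ward-identity
analysis. [cite: MontvayMunster1994, §5.3.1 (5.146)–(5.150)] [cite: KarstenSmit1981] -/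
def qcdThreePointTransform (β : ℝ) (S : ℕ) (mq : Fin Nf → ℝ) (a : ℝ)
    (X : QCDLatticeObservable Nf R₁) (Y : QCDLatticeObservable Nf R₂) (Z : QCDLatticeObservable Nf R₃)
    (p q : Fin 4 → ℝ) : ℂ :=
  ((a ^ 8 : ℝ) : ℂ) * ∑ x ∈ box 4 S, ∑ y ∈ box 4 S,
    Complex.exp (Complex.I * ((∑ i : Fin 4, (p i * (a * (x i : ℝ)) + q i * (a * (y i : ℝ))) : ℝ) : ℂ)) *
      qcdThreePoint β S mq X Y Z x y

/-- At zero momenta the transform is the plain double sum `a⁸ ∑_{x,y} ⟨X(x)Y(y)Z(0)⟩`. [folklore] -/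
theorem qcdThreePointTransform_zero_zero (β : ℝ) (S : ℕ) (mq : Fin Nf → ℝ) (a : ℝ)
    (X : QCDLatticeObservable Nf R₁) (Y : QCDLatticeObservable Nf R₂) (Z : QCDLatticeObservable Nf R₃) :
    qcdThreePointTransform β S mq a X Y Z 0 0 =
      ((a ^ 8 : ℝ) : ℂ) * ∑ x ∈ box 4 S, ∑ y ∈ box 4 S, qcdThreePoint β S mq X Y Z x y := by
  simp [qcdThreePointTransform]

end ThreePoint

/-! ### Truncated reflected pairings -/

section ReflectedPairing

variable {R₁ R₂ : ℕ}

/-- **The reflected pair `Θ(X(x) Y(y)) = ΘY(θy) · ΘX(θx)`** on the torus of side `2S+1`: the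
Osterwalder–Seiler adjoints (`osAdjoint`) placed at the site-reflected positions (`siteReflect`), in
the reversed order in which the antilinear `Θ` returns a product. [cite: OsterwalderSeiler1978, §2] [cite: MontvayMunster1994, §4.2.3 (4.90)–(4.92)] -/
def reflectedPair (S : ℕ) (X : QCDLatticeObservable Nf R₁) (Y : QCDLatticeObservable Nf R₂)
    (x y : LatticeModels.Site 4) (U : GaugeConfig 4 (2 * S + 1) 𝔾) : FermiAlg Nf (2 * S + 1) :=
  Y.osAdjoint.onTorus (2 * S + 1) (siteReflect y) U * X.osAdjoint.onTorus (2 * S + 1) (siteReflect x) U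

/-- **The pair `X(x) Y(y)`** on the torus of side `2S+1`. [cite: OsterwalderSeiler1978, §2] -/
def pairProduct (S : ℕ) (X : QCDLatticeObservable Nf R₁) (Y : QCDLatticeObservable Nf R₂)
    (x y : LatticeModels.Site 4) (U : GaugeConfig 4 (2 * S + 1) 𝔾) : FermiAlg Nf (2 * S + 1) :=
  X.onTorus (2 * S + 1) x U * Y.onTorus (2 * S + 1) y U

/-- **The truncated reflected pairing**
`⟨ΘY(θy) ΘX(θx) · X(x) Y(y)⟩ − ⟨ΘY(θy) ΘX(θx)⟩ ⟨X(x) Y(y)⟩` on the torus of side `2S+1` at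
`(β, m)` (`qcdTorusExpect`): the connected reflection-positivity form `⟨Θ(F) F⟩ − |⟨F⟩|²` of the
pair `F = X(x)Y(y)`, whose bounds uniform in the quark mass are the "truncated reflected pair bounds"
of the current-sector analysis. [cite: MontvayMunster1994, §4.2.3 (4.90)] [cite: OsterwalderSeiler1978, §§2–4] -/
def qcdTruncatedReflectedPairing (β : ℝ) (S : ℕ) (mq : Fin Nf → ℝ) (X : QCDLatticeObservable Nf R₁)
    (Y : QCDLatticeObservable Nf R₂) (x y : LatticeModels.Site 4) : ℂ :=
  qcdTorusExpect β (2 * S + 1) mq (fun U => reflectedPair S X Y x y U * pairProduct S X Y x y U) -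
    qcdTorusExpect β (2 * S + 1) mq (reflectedPair S X Y x y) *
      qcdTorusExpect β (2 * S + 1) mq (pairProduct S X Y x y)

end ReflectedPairing

end Literature.MathematicalPhysics.QuantumFieldTheory

end
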